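import Summits.MatrixMultiplication.MatrixMultiplication.Theorems.SoloInformedCwTwoOrientHall
import Summits.MatrixMultiplication.MatrixMultiplication.Theorems.SoloInformedCwTwoOnePairDesign
import Summits.MatrixMultiplication.MatrixMultiplication.Theorems.SoloInformedCwTwoDoorClosure

/-!
# CONJECTURE L (levels of working orientations) and the mixed-closure principle it implies

`SoloInformedCwTwoOrientHall` typed ORIENT-HALL / HALF-ORIENT.  The seat's data (CLAIMS c160, gen 13: 254 + 106 + 92 + 10
hard designs with `p = 2, 3, 4, 5`, 219 981 random and 773 802 adversarially searched `p = 2` designs, no violation) suggest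
a different SHAPE statement for the set `W ⊂ {T,U}^p` of working one-sided orientations of a mixed design:

**CONJECTURE L.**  For `p ≥ 2` and every `0 < j < p` some working orientation orients exactly `j` pairs `U`
(`LevelConjecture`).  At `p = 2` it reads "TU or UT works" — the recommended concrete form of the first open case
(Theorem B) of HALL-6.  (The extreme levels all-T / all-U fail routinely; 'W has two adjacent members', 'W meets every
facet', 'W has an antipodal pair' are refuted by data.)

This file types L and proves the chain L ⟹ MIXED CLOSURE for ALL `(p, q)` (`mixedClosure_of_levelConjecture`), using
L for `p ≥ 2`, Theorem A (`onePair_mixedClosure_of_isMixedDesign`) for `p = 1`, and the new unconditional `p = 0` case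
`zeroPair_hallSix` (subset sums of a mixed design are distinct), and then L ⟹ D7-CLOSURE AT THE DOOR for every integer
weighted design (`doorClosure_of_levelConjecture`, through a closure-principle version of the sorting argument of
`SoloInformedCwTwoDoorClosure`).

Written by the solo-informed seat (gen 13); standard axioms only.
-/

namespace Summit.MatrixMultiplication.MatrixMultiplication.Theorems

open Finset

/-- The number of pairs an orientation orients `U` (trade `s + d ↦ 2d`). -/
def uCount {p : ℕ} (o : Fin p → Bool) : ℕ := (Finset.univ.filter fun k => o k = true).card

/-- **CONJECTURE L** (CLAIMS c160): for a mixed design with `p ≥ 2` pairs, every middle level `0 < j < p` of the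
orientation cube contains a working orientation.  (Conjecture; a `Prop`, never assumed globally.) -/
def LevelConjecture : Prop :=
  ∀ {p q : ℕ} (s d : Fin p → ℕ) (t : Fin q → ℕ), IsMixedDesign s d t →
    ∀ j, 0 < j → j < p → ∃ o : Fin p → Bool, uCount o = j ∧ OrientedHallSix s d t o

/-- L gives HALL-6 from two pairs on (use level `1`). -/
theorem hallSix_of_levelConjecture (hL : LevelConjecture) {p q : ℕ} (hp : 2 ≤ p) (s d : Fin p → ℕ)
    (t : Fin q → ℕ) (hD : IsMixedDesign s d t) : HallSix s d t := by
  obtain ⟨o, -, ho⟩ := hL s d t hD 1 (by omega) (by omega)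
  exact hallSix_of_orientedHallSix s d t o ho

/-- **`p = 0`, unconditionally**: a mixed system without pairs satisfies HALL-6 — the subset sums of a mixed design
are pairwise distinct (the relation `χ_A - χ_B` is allowed in both directions) and at most `σ`. -/
theorem zeroPair_hallSix {q : ℕ} (s d : Fin 0 → ℕ) (t : Fin q → ℕ) (hD : IsMixedDesign s d t) : HallSix s d t := by
  classical
  obtain ⟨_, ys, yd, yt, hy⟩ := hD
  refine ⟨fun _ _ => 0, fun m => ?_, ?_⟩
  · -- representatives are subset sums, at most `∑ t_i = σ`
    simp only [candVal, mixedSigma, Finset.univ_eq_empty, Finset.sum_empty, zero_add]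
    exact Finset.sum_le_sum_of_subset_of_nonneg (Finset.subset_univ _) fun _ _ _ => Nat.zero_le _
  · intro m m' hmm
    have hsum : ∑ i ∈ m.2, t i = ∑ i ∈ m'.2, t i := by
      simpa [candVal, Finset.univ_eq_empty] using hmm
    -- the allowed relation χ_A - χ_B (and its negative) has value 0, so it must vanish
    have key : ∀ A B : Finset (Fin q), ∑ i ∈ A, t i = ∑ i ∈ B, t i →
        (fun i => chiZ A i - chiZ B i) ≠ 0 → 1 ≤ ∑ i, (chiZ A i - chiZ B i) * yt i := by
      intro A B hAB hne
      have hval : (∑ k : Fin 0, ((0 : ℤ) * (s k : ℤ) + (0 : ℤ) * (d k : ℤ))) +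
          ∑ i, (chiZ A i - chiZ B i) * (t i : ℤ) = 0 := by
        have hA := subsetSum_eq_chi t A
        have hB := subsetSum_eq_chi t B
        simp only [subsetSum] at hA hB
        simp only [Finset.univ_eq_empty, Finset.sum_empty, zero_add, sub_mul, Finset.sum_sub_distrib, ← hA, ← hB,
          hAB, sub_self]
      have h := hy (fun _ => 0) (fun _ => 0) (fun i => chiZ A i - chiZ B i)
        ⟨fun k => k.elim0, fun i => chiZ_sub_bound A B i⟩ hval (Or.inr (Or.inr hne))
      simpa using h
    have hAB : m.2 = m'.2 := by
      by_contra hne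
      have h1 : (fun i => chiZ m.2 i - chiZ m'.2 i) ≠ 0 := fun h0 => hne (eq_of_chiZ_sub_eq_zero _ _ h0)
      have h2 : (fun i => chiZ m'.2 i - chiZ m.2 i) ≠ 0 := fun h0 => hne (eq_of_chiZ_sub_eq_zero _ _ h0).symm
      have k1 := key m.2 m'.2 hsum h1
      have k2 := key m'.2 m.2 hsum.symm h2
      have : ∑ i, (chiZ m'.2 i - chiZ m.2 i) * yt i = -∑ i, (chiZ m.2 i - chiZ m'.2 i) * yt i := by
        rw [← Finset.sum_neg_distrib]; exact Finset.sum_congr rfl fun i _ => by ring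
      linarith
    have h1 : m.1 = m'.1 := funext fun k => k.elim0
    exact Prod.ext h1 hAB

/-- **The mixed-closure principle** `4^p · 2^q ≤ σ + 1` for every mixed design, as a `Prop`. -/
def MixedClosurePrinciple : Prop :=
  ∀ {p q : ℕ} (s d : Fin p → ℕ) (t : Fin q → ℕ), IsMixedDesign s d t → 4 ^ p * 2 ^ q ≤ mixedSigma s d t + 1

/-- HALL-6 implies the mixed-closure principle. -/
theorem mixedClosurePrinciple_of_hallSixConjecture (h : HallSixConjecture) : MixedClosurePrinciple :=
  fun s d t hD => mixedClosure_of_hallSixConjecture h s d t hD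

/-- **L ⟹ MIXED CLOSURE for all `(p, q)`**: L for `p ≥ 2`, Theorem A for `p = 1`, `zeroPair_hallSix` for `p = 0`. -/
theorem mixedClosure_of_levelConjecture (hL : LevelConjecture) : MixedClosurePrinciple := by
  intro p q s d t hD
  rcases Nat.lt_or_ge p 2 with hp | hp
  · interval_cases p
    · exact hallSix_closure s d t (zeroPair_hallSix s d t hD)
    · have h := onePair_mixedClosure_of_isMixedDesign s d t (hD.1 0) hD
      simpa using h
  · exact hallSix_closure s d t (hallSix_of_levelConjecture hL hp s d t hD)

/-! ## From a mixed-closure principle to the door, for every integer weighted design -/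

/-- A closure principle closes the door for normal-form designs. -/
theorem doorClosure_of_principle_normal (hMC : MixedClosurePrinciple) {N : ℕ} (s d : Fin N → ℕ)
    (θ : Fin N → Fin 3 → ℕ) (hsd : ∀ k, s k < d k) (hdes : IsDoorDesign (normDigits s d) θ) :
    4 ^ N ≤ (∑ k, (s k + d k)) + 1 := by
  have h := hMC s d (Fin.elim0 : Fin 0 → ℕ) (isMixedDesign_of_isDoorDesign s d θ hsd hdes)
  simpa [mixedSigma] using h

/-- A closure principle closes the door for increasingly ordered designs. -/
theorem doorClosure_of_principle_ordered (hMC : MixedClosurePrinciple) {N : ℕ} (F θ : Fin N → Fin 3 → ℕ)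
    (hord : ∀ k, F k 0 < F k 1 ∧ F k 1 < F k 2) (hdes : IsDoorDesign (fun k j => (F k j : ℤ)) θ) :
    4 ^ N ≤ digitSigma F + 1 := by
  have hsd : ∀ k, F k 1 - F k 0 < F k 2 - F k 0 := fun k => by have := hord k; omega
  have h := doorClosure_of_principle_normal hMC (fun k => F k 1 - F k 0) (fun k => F k 2 - F k 0) θ hsd
    (isDoorDesign_normDigits_of_ordered F θ hord hdes)
  have hle : ∑ k, ((F k 1 - F k 0) + (F k 2 - F k 0)) ≤ digitSigma F := by
    unfold digitSigma
    exact Finset.sum_le_sum fun k _ => by have := hord k; omega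
  omega

/-- **A closure principle closes the door for EVERY integer weighted design** (sort each digit triple). -/
theorem doorClosure_of_principle (hMC : MixedClosurePrinciple) {N : ℕ} (F θ : Fin N → Fin 3 → ℕ)
    (hdes : IsDoorDesign (fun k j => (F k j : ℤ)) θ) : 4 ^ N ≤ digitSigma F + 1 := by
  classical
  let π : Fin N → Equiv.Perm (Fin 3) := fun k => Tuple.sort (F k)
  have hinj : ∀ k, Function.Injective (F k) := fun k i j hFij => by
    by_contra hij
    exact hdes.apply_ne k hij (by exact_mod_cast hFij)
  have hmono : ∀ k, StrictMono (F k ∘ π k) := fun k =>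
    (Tuple.monotone_sort (F k)).strictMono_of_injective ((hinj k).comp (π k).injective)
  have hord : ∀ k, F k (π k 0) < F k (π k 1) ∧ F k (π k 1) < F k (π k 2) := fun k =>
    ⟨hmono k (show (0 : Fin 3) < 1 by decide), hmono k (show (1 : Fin 3) < 2 by decide)⟩
  have hdes' : IsDoorDesign (fun k j => ((F k (π k j) : ℕ) : ℤ)) (fun k j => θ k (π k j)) :=
    isDoorDesign_perm (fun k j => (F k j : ℤ)) θ π hdes
  have h := doorClosure_of_principle_ordered hMC (fun k j => F k (π k j)) (fun k j => θ k (π k j)) hord hdes'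
  have hσ : digitSigma (fun k j => F k (π k j)) = digitSigma F := by
    unfold digitSigma
    refine Finset.sum_congr rfl fun k _ => ?_
    have := Equiv.sum_comp (π k) (F k)
    simpa [Fin.sum_univ_three] using this
  omega

/-- **L ⟹ D7-CLOSURE AT THE DOOR**: under CONJECTURE L no integer weighted design of the door certifies border rank of
`T_{cw,2}^{⊠N}` below `4^N`. -/
theorem doorClosure_of_levelConjecture (hL : LevelConjecture) {N : ℕ} (F θ : Fin N → Fin 3 → ℕ)
    (hdes : IsDoorDesign (fun k j => (F k j : ℤ)) θ) : 4 ^ N ≤ digitSigma F + 1 :=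
  doorClosure_of_principle (mixedClosure_of_levelConjecture hL) F θ hdes

/-- The same from HALF-ORIENT (completing the chain of `SoloInformedCwTwoOrientHall` down to the door). -/
theorem doorClosure_of_halfOrientConjecture (h : HalfOrientConjecture) {N : ℕ} (F θ : Fin N → Fin 3 → ℕ)
    (hdes : IsDoorDesign (fun k j => (F k j : ℤ)) θ) : 4 ^ N ≤ digitSigma F + 1 :=
  doorClosure_of_principle (mixedClosurePrinciple_of_hallSixConjecture
    (hallSixConjecture_of_orientHallConjecture (orientHallConjecture_of_halfOrientConjecture h))) F θ hdes

end Summit.MatrixMultiplication.MatrixMultiplication.Theorems
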